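import Literature.NumberTheory.PAdicHodge.BdRPlusLogTypeSeries
import Literature.NumberTheory.PAdicHodge.BdRPlusLogLatticeTheta
import HarnessLib

/-!
# `θ` of a logarithmic-type series modulo `Fil^k`: `θ(ℓ_b(y)) = Σ (b_m/m) θ(y)^m` in `ℂ_F`

Topic `Literature/NumberTheory/PAdicHodge`; namespace `Literature.NumberTheory.PAdicHodge.GaloisContinuity`. THEOREMS ONLY (no definition, no instance,
no named fact, no `sorry`). Sequel of `BdRPlusLogTypeSeries` (`IsLogTypeModFil b k y L`) and the abstract version of `BdRPlusLogLatticeTheta` §1–2 (the case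
`b_m = (−1)^{m+1}`): for `y ∈ (p, ξ)𝔸_inf`, `k ≥ 1` and a value `L` of `ℓ_b(y) = Σ (b_m/m) ι(y)^m` modulo `Fil^k`,

* `thetaBdR_qpToBdR_eq_algebraMap_padicRingHom` — `θ(ℚ_p → B_dR⁺) = (ℚ_p → F → ℂ_F)` with the CANONICAL `LocalField.padicRingHom`;
* `thetaBdR_logTypePartialSum` — `θ(P^b_M(y)) = Σ_{m<M} (b_{m+1}/(m+1)) · θ(ι y)^{m+1}` (the classical partial sums at `θ(y) ∈ p𝒪_{ℂ_F}`);
* ★ `IsLogTypeModFil.tendsto_thetaBdR` — these partial sums converge to `θ(L)` in `ℂ_F`;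
* ★ `IsLogTypeModFil.thetaBdR_eq_of_tendsto` — hence `θ(L)` IS the classical `p`-adic value of the series at `θ(y)` whenever the latter is given as the limit
  of its partial sums (e.g. `log_W(θ[ũ]) = log_ω(P)` for Fontaine's integral `[ũ]` of a point `P`, tree `AinfWeierstrassKummerIntegral`).

Floor (H4) step (3) of `Summits/…/Cruxes/StarredOptimalManinUnitFiveSeven/Lines/kato-lever-K3-B2-road.md` (memo `…-K3-H4-log.md` §3b; crux K★
`stmt-BirchSwinnertonDyer-22226`): where `log_ω(P)` enters [REC]. Infrastructure only; BSD / K★ are not proved by any of this.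

## References
* J.-M. Fontaine, *Le corps des périodes p-adiques*, Astérisque 223 (1994), Exp. II §1.5.2–1.5.4. [FontaineAsterisque223III]
* J.-M. Fontaine, *Formes différentielles et modules de Tate…*, Invent. Math. 65 (1982), §5. [Fontaine1982FormesDifferentielles]
-/

noncomputable section

namespace Literature.NumberTheory.PAdicHodge

namespace GaloisContinuity

open ValuativeRel Field Ideal WittVector Finset Filter
open _root_.Topology
open Literature.NumberTheory.GaloisRepresentations Literature.NumberTheory.GaloisRepresentations.IsNonarchimedeanLocalField

variable {F : Type} [Field F] [ValuativeRel F] [TopologicalSpace F] [IsNonarchimedeanLocalField F]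
  [CharZero F] {p : ℕ} [Fact p.Prime] [Fact (¬ IsUnit (p : integerC F))]
  [IsAdicComplete (Ideal.span {(p : integerC F)}) (integerC F)]

/-- **`θ ∘ (ℚ_p → B_dR⁺) = (ℚ_p → F → ℂ_F)`** with the canonical `LocalField.padicRingHom`. [cite: FontaineAsterisque223III, Exp. II §1.5.3] -/
theorem thetaBdR_qpToBdR_eq_algebraMap_padicRingHom (hp : valuation F p < 1) (q : ℚ_[p]) :
    thetaBdR (qpToBdR q : BDeRhamPlus (integerC F) p) = algebraMap F (CompletedAlgClosure F) (LocalField.padicRingHom F p hp q) := by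
  rw [thetaBdR_qpToBdR hp, PadicBase.algebraMap_eq, PadicBase.emb_apply, RingEquiv.apply_symm_apply]

/-- **`θ(P^b_M(y))` is the `M`-th classical partial sum** `Σ_{m<M} (b_{m+1}/(m+1)) θ(ι y)^{m+1}` in `ℂ_F`.
[cite: Fontaine1982FormesDifferentielles, §5] -/
theorem thetaBdR_logTypePartialSum (hp : valuation F p < 1) (b : ℕ → ℤ_[p]) (y : Ainf (p := p) F) (M : ℕ) :
    thetaBdR (logTypePartialSum b y M) = ∑ m ∈ range M,
      algebraMap F (CompletedAlgClosure F) (LocalField.padicRingHom F p hp (((b (m + 1) : ℤ_[p]) : ℚ_[p]) / ((m : ℚ_[p]) + 1))) *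
        thetaBdR (ainfToBdR y) ^ (m + 1) := by
  rw [logTypePartialSum, map_sum]
  refine Finset.sum_congr rfl fun m _ => ?_
  rw [logTypeTerm, map_mul, map_pow, thetaBdR_qpToBdR_eq_algebraMap_padicRingHom hp, Nat.cast_add, Nat.cast_one]

/-- ★ **`θ(P^b_M(y)) → θ(L)` in `ℂ_F`** for a value `L` of `ℓ_b(y)` modulo `Fil^k`, `k ≥ 1` (`L − P^b_M(y) ∈ Λ(j, k)` for `M ≫ 0` and
`‖θ(Λ(j,k))‖ ≤ ‖p‖^j → 0`). [cite: FontaineAsterisque223III, Exp. II §1.5.4] -/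
theorem IsLogTypeModFil.tendsto_thetaBdR {b : ℕ → ℤ_[p]} {k : ℕ} (hk : 1 ≤ k) {y : Ainf (p := p) F} {L : BDeRhamPlus (integerC F) p}
    (hL : IsLogTypeModFil b k y L) : Tendsto (fun M => thetaBdR (logTypePartialSum b y M)) atTop (𝓝 (thetaBdR L)) := by
  rw [Metric.tendsto_atTop]
  intro ε hε
  obtain ⟨j, hj⟩ := exists_pow_lt_of_lt_one hε (norm_natCast_C_lt_one' (F := F) (p := p))
  obtain ⟨M₀, hM₀⟩ := hL j
  refine ⟨M₀, fun M hM => ?_⟩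
  obtain ⟨a, w, h⟩ := hM₀ M hM
  rw [dist_eq_norm, ← norm_neg, neg_sub, ← map_sub, h]
  exact (norm_thetaBdR_lattice_le hk a w).trans_lt hj

/-- ★ **`θ(L)` is the classical value**: if the classical partial sums `Σ_{m<M} (b_{m+1}/(m+1)) θ(ι y)^{m+1}` converge to `c ∈ ℂ_F`, then `θ(L) = c`
for every value `L` of `ℓ_b(y)` modulo `Fil^k`, `k ≥ 1` (limits in `ℂ_F` are unique). [cite: Fontaine1982FormesDifferentielles, §5] -/
theorem IsLogTypeModFil.thetaBdR_eq_of_tendsto (hp : valuation F p < 1) {b : ℕ → ℤ_[p]} {k : ℕ} (hk : 1 ≤ k) {y : Ainf (p := p) F}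
    {L : BDeRhamPlus (integerC F) p} (hL : IsLogTypeModFil b k y L) {c : CompletedAlgClosure F}
    (hc : Tendsto (fun M => ∑ m ∈ range M,
      algebraMap F (CompletedAlgClosure F) (LocalField.padicRingHom F p hp (((b (m + 1) : ℤ_[p]) : ℚ_[p]) / ((m : ℚ_[p]) + 1))) *
        thetaBdR (ainfToBdR y) ^ (m + 1)) atTop (𝓝 c)) :
    thetaBdR L = c := by
  have h := hL.tendsto_thetaBdR hk
  simp only [thetaBdR_logTypePartialSum hp] at h
  exact tendsto_nhds_unique h hc

end GaloisContinuity

end Literature.NumberTheory.PAdicHodge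

end
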